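import Summits.QuantumFields.BalabanUV.T4Continuum.Support.NE7SliceStepContraction
import Summits.QuantumFields.BalabanUV.T4Continuum.Support.NE7SliceStepErrorField
import Summits.QuantumFields.BalabanUV.T4Continuum.Support.NE7SliceSplitUnique
import Summits.QuantumFields.BalabanUV.T4Continuum.Support.NE3CurvedFrameKill
import HarnessLib

/-!
# NE7SliceStepOneStep — ONE STEP OF THE (S1) ITERATION, SPLIT AND SIZED (memo ROAD-G100 §2.6–§2.7, item F3c, second half): the next tangent part `T¹ = Ỹ⁰ + E′` with datum `h¹`
# (`h¹ − framePotW Ỹ⁰ = j_c`) splits as `T¹ = Ỹ¹ + gaugeDir W ζ¹`, `Ỹ¹ := Ỹ⁰ + Ỹ_{E′} ∈ 𝒯_E(W)`, `bmeanIterW ζ¹ = −(framePotW T¹ − h¹)`, with `‖Ỹ¹ − Ỹ⁰‖ ≤ s_E`, the new defect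
# `‖gaugeDir W ζ¹‖ ≤ e_E + s_E`, the new frame mismatch `‖framePotW T¹ − h¹‖ ≤ frameC·M·e_E + e_c` and `‖ζ¹‖ ≤ 2((frameC·M·e_E + e_c) + 2dM(e_E + s_E))` — every size linear in the junk

Cell `pub-balaban`, rung (B)+1 sub-cell t4, lineage `b2b-balaban-t4-ne7-p1`, generation 101 (CRUX PROVER NE7 #1 = OWNER of BINDER row NE7).  Memo `t4/b2b-balaban-t4-ne7-p1-g101/ROAD-G101.md`.
STEP DATA (`NE7SliceStepIdentities`, `NE7SliceStepErrorSizes`, `NE7SliceStepErrorField`): previous slice part `Ỹ⁰ ∈ 𝒯_E(W)`; bond junk `J` (skew, `(tower)`-periodic, `‖J‖ ≤ e_J`,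
`‖curl_W J‖ ≤ c_J`), corner junk `j_c` (skew, `N`-periodic, `‖j_c‖ ≤ e_c`), coarse data `φ⁰, φ¹` (skew, `N`-periodic, `φ⁰ − φ¹ = −dirIter J + gaugeDir_V j_c` = `phi_sub_phi_succ`), error field
`E′ := J + (rightInvW φ⁰ − rightInvW φ¹)` (so `T¹ = Ỹ⁰ + E′` = `tangent_succ`), next corner log `h¹` with `h¹ − framePotW Ỹ⁰ = j_c` (= `datum_succ`).  THIS FILE: `dirIter E′ = gaugeDir_V j_c`
(`rightInvW_exact`), the split of `E′` with its sizes (`NE7SliceStepContraction.split_error_sized`, the curved sup letter (L) displayed as `hLet` exactly as there — discharged for `d+1 ≥ 2` by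
`NE7CurvedSupLetter.curved_sup_letter`), `Ỹ¹ := Ỹ⁰ + Ỹ_{E′} ∈ 𝒯_E` (`mem_energyBlockLandauW_add`), and the normalisation of `ζ¹ := ζ_{E′}` against `T¹, h¹` (`framePotW_add`).  The sizes
`e_E ≥ e_J + supC∕(M(1−θ))·e_φ`, `c_E ≥ c_J + supCurlC∕(M²(1−θ))·e_φ` (`e_φ := (3+12d)M·e_J + 2e_c`) are those of `NE7SliceStepErrorField`.
WHAT ([folklore]; 0 def, 0 sorry).  §1 `dirIter_errorField`.  §2 **`one_step_split_sized`** (statement displayed).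
HONEST FRAMING (page 1): linear bookkeeping over landed letters at ONE background, (L) displayed as a hypothesis; nothing of Bałaban's asserted; NOT the assembled contraction constant, NOT (S1), NOT NE7;
spine 0∕9; finite T⁴ rung (B)+1 — NOT infinite volume, NOT mass gap, NOT BetaPertH, NOT Clay.  Continuum YM on T⁴ ⇐ BetaPertH ∧ nine spine estimates (0/9 proved); BetaPertH ⇐ (D1) ∧ (D4) ∧ CAP+tail;
G-an2-4 gates asym, D1 and NE2/3/4.
-/

set_option autoImplicit false

open scoped BigOperators Matrix.Norms.L2Operator
open Finset

namespace Summit.QuantumFields.BalabanUV.T4Continuum.NE7SliceStepOneStep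

open Literature.MathematicalPhysics.QuantumFieldTheory.Balaban1983to89
open B7Prop1Explicit B7Prop2Explicit
open T4AveragingDeficitWall (IsUnitaryCfg IsSkewDir SmallField Ad curlAt)
open T4AveragingDeficitWallBoundary (IsPeriodicCfg)
open AveragingDeficitPeriodicCounting (IsPeriodicDir)
open AveragingDeficitTwoLevelPrep (prop1Radius)
open AveragingDeficitMultiLevelPrep (cavgIter LevelSmall tower)
open BlockAveragePushDirGauge (gaugeDir)
open NE3TangentCovariantTower (dirIter framePotW dirIter_add)
open NE3ResidualSliceRep (dirIter_sub)
open NE3CurvedFrameKill (framePotW_add)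
open NE3CovariantBlockMean (bmeanIterW)
open NE3RightInverseSupLetters (frameC supC)
open NE3HatInvCurlLetters (supCurlC)
open NE3QbarIterCovLiftPrep (cruxC)
open NE3SmoothRightInverseW (rightInvW dirIter_rightInvW)
open NE3LinearisedAverageSup (curvSum)
open NE7MeanZeroGaugeSliceW (energyBlockLandauW)
open NE7SliceSplitUnique (mem_energyBlockLandauW_add)
open SpreadLift (loopRad)
open NE7SliceStepContraction (split_error_sized)
open NE7SliceStepErrorField (errorField_skew errorField_periodic norm_errorField_le norm_curlAt_errorField_le)

noncomputable section

variable {d : ℕ} {n : Type*} [Fintype n] [DecidableEq n]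

section OneStep

variable [Nonempty n] {L : ℕ} (hL : 2 ≤ L) (k : ℕ) {N : ℕ} [NeZero N] {W : Site d → Fin d → (Matrix n n ℂ)ˣ} {x : ℝ}
  (hWu : IsUnitaryCfg W) (hWP : IsPeriodicCfg W ((tower L N (k + 1) : ℕ) : ℤ)) (hx : 0 ≤ x) (hs : LevelSmall d L k x) (hWx : SmallField W x)
  (hθ : cruxC d L * (((L : ℝ) ^ (k + 1)) ^ 2 * x) < 1)
  {φ0 φ1 : Site d → Fin d → Matrix n n ℂ} (hφ0 : IsSkewDir φ0) (hφ1 : IsSkewDir φ1) (hφ0P : IsPeriodicDir φ0 (N : ℤ)) (hφ1P : IsPeriodicDir φ1 (N : ℤ))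
  {J : Site d → Fin d → Matrix n n ℂ} {jc : Site d → Matrix n n ℂ}

/-! ## §1 The error field is exact over the corner junk -/

include hWP hφ0P hφ1P in
/-- **`dirIter E′ = gaugeDir_V j_c`**: `dirIter(J + Rφ⁰ − Rφ¹) = dirIter J + φ⁰ − φ¹ = gaugeDir_V j_c` (`rightInvW` is an exact right inverse, `φ⁰ − φ¹ = −dirIter J + gaugeDir_V j_c`). [folklore] -/
theorem dirIter_errorField (hdφ : ∀ z κ, φ0 z κ - φ1 z κ = -dirIter L (k + 1) W J z κ + gaugeDir (cavgIter L (k + 1) W) jc z κ) :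
    dirIter L (k + 1) W (fun y κ => J y κ + (rightInvW hL k hWu hx hs hWx N hθ hφ0 y κ - rightInvW hL k hWu hx hs hWx N hθ hφ1 y κ))
      = gaugeDir (cavgIter L (k + 1) W) jc := by
  have hL1 : 1 ≤ L := by omega
  have e : (fun y κ => J y κ + (rightInvW hL k hWu hx hs hWx N hθ hφ0 y κ - rightInvW hL k hWu hx hs hWx N hθ hφ1 y κ))
      = fun y κ => J y κ + (fun y κ => rightInvW hL k hWu hx hs hWx N hθ hφ0 y κ - rightInvW hL k hWu hx hs hWx N hθ hφ1 y κ) y κ := rfl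
  rw [e, dirIter_add hL1 k hWu hx hs hWx, dirIter_sub hL1 k hWu hx hs hWx, dirIter_rightInvW hL k hWu hWP hx hs hWx hθ hφ0 hφ0P,
    dirIter_rightInvW hL k hWu hWP hx hs hWx hθ hφ1 hφ1P]
  funext z κ
  simp only [hdφ z κ]
  abel

/-! ## §2 One step, split and sized -/

include hWP hφ0P hφ1P in
/-- **ONE STEP OF THE (S1) ITERATION, SPLIT AND SIZED** (multi-level small-field class at level `k+1`, `d ≥ 1`, `L ≥ 2`, `W` unitary `(tower L N (k+1))`-periodic with `SmallField W x`, Poincaré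
parameter `θ_P ≤ 1∕2`, `cruxC·M²x < 1`, `M²x ≤ 1`, `curvSum ≤ 2L∕3`, the curved sup letter (L) with constant `K ≥ 0` displayed as `hLet` and the absorption `16Kd·M²x ≤ 1∕2`): with the step data of
the header (`Ỹ⁰ ∈ 𝒯_E`, `J`, `j_c`, `φ⁰ − φ¹ = −dirIter J + gaugeDir_V j_c`, `h¹ − framePotW Ỹ⁰ = j_c`, sizes `e_J, c_J, e_c` and any `e_E, c_E` above the error-field sizes), the next tangent part
`T¹ = Ỹ⁰ + (J + Rφ⁰ − Rφ¹)` splits with datum `h¹`, and the displayed sizes hold (`M = L^{k+1}`, `s_E := 2KM·c_E + 8K(M²x)(frameC·M·e_E + e_c)∕M + 16Kd(M²x)·e_E`). [folklore] -/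
theorem one_step_split_sized (hd : 0 < d)
    (hθP : 4 * (d : ℝ) ^ 2 * ((L : ℝ) ^ (k + 1) - 1) ^ 2 * x + 16 * d * loopRad d L ((prop1Radius d L)^[k] x)
        + 4 * d * ((d : ℝ) - 1) * ((L : ℝ) ^ (k + 1) - 1) ^ 2 * x ≤ 1 / 2)
    {K : ℝ} (hK : 0 ≤ K) (hKε : 16 * K * d * (((L : ℝ) ^ (k + 1)) ^ 2 * x) ≤ 1 / 2)
    (hLet : ∀ Y : Site d → Fin d → Matrix n n ℂ, Y ∈ energyBlockLandauW (d := d) (n := n) L N (k + 1) W →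
      ∀ B : ℝ, (∀ (z : Site d) (μ ν : Fin d), μ ≠ ν → ‖curlAt W Y z μ ν‖ ≤ B) → ∀ (y : Site d) (κ : Fin d), ‖Y y κ‖ ≤ K * (L : ℝ) ^ (k + 1) * B)
    (hε : ((L : ℝ) ^ (k + 1)) ^ 2 * x ≤ 1) (hA : curvSum d L (k + 1) x ≤ 2 / 3 * L)
    {Yt0 : Site d → Fin d → Matrix n n ℂ} (hYt0 : Yt0 ∈ energyBlockLandauW (d := d) (n := n) L N (k + 1) W)
    (hJs : IsSkewDir J) (hJP : IsPeriodicDir J ((tower L N (k + 1) : ℕ) : ℤ))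
    (hjcs : ∀ z, jc z ∈ skewAdjoint (Matrix n n ℂ)) (hjcP : ∀ (z : Site d) (i : Fin d), jc (z + (N : ℤ) • e i) = jc z)
    (hdφ : ∀ z κ, φ0 z κ - φ1 z κ = -dirIter L (k + 1) W J z κ + gaugeDir (cavgIter L (k + 1) W) jc z κ)
    {h1 : Site d → Matrix n n ℂ} (hdat : ∀ z, h1 z - framePotW L (k + 1) W Yt0 z = jc z)
    {eJ cJ ec eE cE : ℝ} (heJ0 : 0 ≤ eJ) (hec0 : 0 ≤ ec) (heE0 : 0 ≤ eE) (hcE0 : 0 ≤ cE)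
    (hJ : ∀ y κ, ‖J y κ‖ ≤ eJ) (hcJ : ∀ (z : Site d) (μ ν : Fin d), μ ≠ ν → ‖curlAt W J z μ ν‖ ≤ cJ) (hjc : ∀ z, ‖jc z‖ ≤ ec)
    (heE : eJ + supC d L / ((L : ℝ) ^ (k + 1) * (1 - cruxC d L * (((L : ℝ) ^ (k + 1)) ^ 2 * x))) * ((3 + 12 * (d : ℝ)) * (L : ℝ) ^ (k + 1) * eJ + 2 * ec) ≤ eE)
    (hcE : cJ + supCurlC d L / (((L : ℝ) ^ (k + 1)) ^ 2 * (1 - cruxC d L * (((L : ℝ) ^ (k + 1)) ^ 2 * x))) * ((3 + 12 * (d : ℝ)) * (L : ℝ) ^ (k + 1) * eJ + 2 * ec) ≤ cE) :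
    ∃ (ζ : Site d → Matrix n n ℂ) (Yt1 : Site d → Fin d → Matrix n n ℂ),
      (∀ y, ζ y ∈ skewAdjoint (Matrix n n ℂ)) ∧ (∀ (y : Site d) (i : Fin d), ζ (y + ((tower L N (k + 1) : ℕ) : ℤ) • e i) = ζ y) ∧
      Yt1 ∈ energyBlockLandauW (d := d) (n := n) L N (k + 1) W ∧
      (∀ y μ, Yt0 y μ + (J y μ + (rightInvW hL k hWu hx hs hWx N hθ hφ0 y μ - rightInvW hL k hWu hx hs hWx N hθ hφ1 y μ)) = Yt1 y μ + gaugeDir W ζ y μ) ∧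
      (∀ z, bmeanIterW L (k + 1) W ζ z
          = -(framePotW L (k + 1) W (fun y μ => Yt0 y μ + (J y μ + (rightInvW hL k hWu hx hs hWx N hθ hφ0 y μ - rightInvW hL k hWu hx hs hWx N hθ hφ1 y μ))) z - h1 z)) ∧
      (∀ z, ‖framePotW L (k + 1) W (fun y μ => Yt0 y μ + (J y μ + (rightInvW hL k hWu hx hs hWx N hθ hφ0 y μ - rightInvW hL k hWu hx hs hWx N hθ hφ1 y μ))) z - h1 z‖
          ≤ frameC d L * (L : ℝ) ^ (k + 1) * eE + ec) ∧
      (∀ y μ, ‖Yt1 y μ - Yt0 y μ‖ ≤ 2 * K * (L : ℝ) ^ (k + 1) * cE + 8 * K * (((L : ℝ) ^ (k + 1)) ^ 2 * x) * (frameC d L * (L : ℝ) ^ (k + 1) * eE + ec) / (L : ℝ) ^ (k + 1)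
          + 16 * K * d * (((L : ℝ) ^ (k + 1)) ^ 2 * x) * eE) ∧
      (∀ y μ, ‖gaugeDir W ζ y μ‖ ≤ eE + (2 * K * (L : ℝ) ^ (k + 1) * cE + 8 * K * (((L : ℝ) ^ (k + 1)) ^ 2 * x) * (frameC d L * (L : ℝ) ^ (k + 1) * eE + ec) / (L : ℝ) ^ (k + 1)
          + 16 * K * d * (((L : ℝ) ^ (k + 1)) ^ 2 * x) * eE)) ∧
      (∀ y, ‖ζ y‖ ≤ 2 * ((frameC d L * (L : ℝ) ^ (k + 1) * eE + ec) + 2 * d * (L : ℝ) ^ (k + 1) *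
          (eE + (2 * K * (L : ℝ) ^ (k + 1) * cE + 8 * K * (((L : ℝ) ^ (k + 1)) ^ 2 * x) * (frameC d L * (L : ℝ) ^ (k + 1) * eE + ec) / (L : ℝ) ^ (k + 1)
            + 16 * K * d * (((L : ℝ) ^ (k + 1)) ^ 2 * x) * eE)))) := by
  have hL1 : 1 ≤ L := by omega
  -- the error field, its exactness and its sizes
  have hEs := errorField_skew (N := N) hL k hWu hx hs hWx hθ hφ0 hφ1 hJs
  have hEP := errorField_periodic hL k hWu hWP hx hs hWx hθ hφ0 hφ1 hJP
  have hdir := dirIter_errorField hL k hWu hWP hx hs hWx hθ hφ0 hφ1 hφ0P hφ1P hdφ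
  have hE : ∀ y κ, ‖J y κ + (rightInvW hL k hWu hx hs hWx N hθ hφ0 y κ - rightInvW hL k hWu hx hs hWx N hθ hφ1 y κ)‖ ≤ eE := fun y κ =>
    (norm_errorField_le hL k hWu hWP hx hs hWx hθ hε hφ0 hφ1 hA hJs hJP hdφ heJ0 hec0 hJ hjc y κ).trans heE
  have hcE' : ∀ (z : Site d) (μ ν : Fin d), μ ≠ ν →
      ‖curlAt W (fun y κ => J y κ + (rightInvW hL k hWu hx hs hWx N hθ hφ0 y κ - rightInvW hL k hWu hx hs hWx N hθ hφ1 y κ)) z μ ν‖ ≤ cE := fun z μ ν hμν =>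
    (norm_curlAt_errorField_le hL k hWu hWP hx hs hWx hθ hε hφ0 hφ1 hA hJs hJP hdφ heJ0 hec0 hJ hcJ hjc z hμν).trans hcE
  -- the split of the error field, sized
  obtain ⟨ζ, YE, hζs, hζP, hYE, hsplit, hmean, hm, hYEle, hδ, hσ⟩ :=
    split_error_sized hd hL k hWu hWP hx hs hWx hθP hK hKε hLet hEs hEP hjcs hjcP hdir heE0 hcE0 hE hcE' hjc
  -- the frame mismatch of `T¹` against `h¹` is that of `E′` against `j_c`
  have hframe : ∀ z, framePotW L (k + 1) W (fun y μ => Yt0 y μ + (J y μ + (rightInvW hL k hWu hx hs hWx N hθ hφ0 y μ - rightInvW hL k hWu hx hs hWx N hθ hφ1 y μ))) z - h1 z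
      = framePotW L (k + 1) W (fun y κ => J y κ + (rightInvW hL k hWu hx hs hWx N hθ hφ0 y κ - rightInvW hL k hWu hx hs hWx N hθ hφ1 y κ)) z - jc z := by
    intro z
    have hfa : framePotW L (k + 1) W (fun y μ => Yt0 y μ + (J y μ + (rightInvW hL k hWu hx hs hWx N hθ hφ0 y μ - rightInvW hL k hWu hx hs hWx N hθ hφ1 y μ))) z
        = framePotW L (k + 1) W Yt0 z + framePotW L (k + 1) W (fun y κ => J y κ + (rightInvW hL k hWu hx hs hWx N hθ hφ0 y κ - rightInvW hL k hWu hx hs hWx N hθ hφ1 y κ)) z :=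
      framePotW_add hL1 k hWu hx hs hWx Yt0 (fun y κ => J y κ + (rightInvW hL k hWu hx hs hWx N hθ hφ0 y κ - rightInvW hL k hWu hx hs hWx N hθ hφ1 y κ)) z
    rw [hfa, ← hdat z]
    abel
  refine ⟨ζ, fun y μ => Yt0 y μ + YE y μ, hζs, hζP, mem_energyBlockLandauW_add hL1 k hWu hx hs hWx hYt0 hYE, fun y μ => ?_, fun z => ?_, fun z => ?_, fun y μ => ?_, hδ, hσ⟩
  · rw [hsplit y μ, add_assoc]
  · rw [hmean z, hframe z]
  · rw [hframe z]; exact hm z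
  · rw [add_sub_cancel_left]; exact hYEle y μ

end OneStep

end

end Summit.QuantumFields.BalabanUV.T4Continuum.NE7SliceStepOneStep
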